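import Summits.Langlands.Langlands.Theorems.IrreducibilityBySelfDualityIrreducibleOffSectorRegularAttached
import Summits.Langlands.Langlands.Theorems.IrreducibilityBySelfDualityIrreducibleOffSectorRankThreeGeneric
import Summits.Langlands.Langlands.Theorems.IrreducibilityBySelfDualityIrreducibleOffSectorOfArithmetic
import Literature.NumberTheory.Automorphic.ClozelAlgebraicity
import HarnessLib

/-!
# `IrreducibleOffSector` from its OPEN REGIONS: a certified map of what is left of the crux
(crux stmt-Langlands-14329 `IrreducibilityBySelfDuality.IrreducibleOffSector`, line `Sketch`;
`--supports` file, STRUCTURAL: no import of the route module)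

The line `Sketch` reduces the crux to the open component `E = ReciprocityUpToIrreducibility`
(stmt-Langlands-14328) in one stroke.  Orthogonally, the children landed by leads 0/c1/c2 close
REGIONS of the crux modulo printed inputs.  This file assembles them into ONE kernel-checked
implication whose antecedents are (i) printed inputs — the named facts lang.S27
(`exists_galoisRep_of_regularAlgebraic` = the route input `GaloisRepOfRegularAlgebraic`), Clozel's
Hecke field (`Clozel1990_heckeEigenvalueField` = the input `HeckeEigenvalueField`), Arthur–Clozel (2.2)
(`JacquetShalika1981_partialPairL_boundary_repData` = the input `PairLBoundaryJS`), Böckle–Hui 2025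
Thm. 1.2 (`isIrreducible_galoisRep_gl3_totallyReal`) and the text of `WeakAbelianSummandHecke` (a
theorem of the tree); (ii) ONE printed conjecture — Buzzard–Gee 2014 Conj. 3.1.6 for L-algebraic
cuspidal `GL_2` (L-algebraic ⇒ L-arithmetic at unramified places); and (iii) FOUR named open regions,
each the crux text restricted to a sub-domain (or the irreducibility statement it reduces to):

* `H3irr` — rank 3, `π` with NO regular infinity type (irregular; no Galois representations are
  attached to such `π` in print);
* `H3esd` — rank 3, `K` neither totally real nor CM, `π` regular and ESSENTIALLY SELF-DUAL at Satake
  level (after Ramakrishnan's descent `π ≃ Ad(σ₀) ⊗ ν`, the case where the lever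
  `HalfIntegralTwistCM` is unavailable);
* `H4att` — rank `≥ 4`, `K` totally real or CM, `π` regular: IRREDUCIBILITY of the semisimple
  representation attached by lang.S27 (C-normalisation) to a regular algebraic cuspidal `π'` on
  `GL_n(𝔸_K)` (the classical conjecture for the Harris–Lan–Taylor–Thorne / Scholze representations,
  known in print only in polarized low-rank cases and then for almost all `ℓ`) — the crux reduces to it
  by `isIrreducible_of_isRegular_of_galoisRep_irreducible` (p117071);
* `H4rest` — rank `≥ 4`, `π` irregular or `K` neither totally real nor CM (no Galois representations
  in print).

and whose conclusion is the crux text VERBATIM (`irreducibleOffSector_text_of_open_regions`).  The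
dispatch: `n = 1` — `isIrreducible_of_rank_one` (p79199); `n = 2` — `isIrreducible_rank_two_of_isLArithmetic`
(p117977: Böckle–Hui Thm. 1.1 + Jacquet–Shalika, given L-arithmeticity); `n = 3`, `K` totally real,
regular — `isIrreducible_rank_three_totallyReal_of_isRegular` (p117071: lang.S27 + BH Thm. 1.2);
`n = 3`, `K` CM, regular — excluded by the sector clause; `n = 3`, other `K`, regular, not essentially
self-dual — `isIrreducible_rank_three_of_isRegular_of_not_essSelfDual` (p117318); `n ≥ 4`, `K`
totally real or CM, regular — `isIrreducible_of_isRegular_of_galoisRep_irreducible` (p117071) fed with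
`H4att`; the rest is `H3irr` / `H3esd` / `H4rest`.  So the crux is EQUIVALENT, modulo printed theorems
and BG 3.1.6(`GL_2`), to the conjunction of its four open regions (the converse implications are
restrictions, resp. — for `H4att` — the a.e.-compatibility of the attached representation).

References: D. Ramakrishnan, *Irreducibility and cuspidality* (2008), §0; G. Böckle, C.-Y. Hui,
Math. Ann. 393 (2025), Thms. 1.1–1.2; K. Buzzard, T. Gee, LMS LNS 414 (2014), Conj. 3.1.6.
-/

noncomputable section

set_option linter.dupNamespace false

open scoped NumberField Classical
open Filter IsDedekindDomain NumberField
open Literature.NumberTheory.Automorphic Literature.NumberTheory.GaloisRepresentations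
open Summit.Langlands

namespace Summit.Langlands.Langlands.Theorems.IrreducibleOffSector

/-- **The crux from its open regions.**  GIVEN the printed inputs lang.S27
(`exists_galoisRep_of_regularAlgebraic`), Böckle–Hui Thm. 1.2 (`isIrreducible_galoisRep_gl3_totallyReal`),
Böckle–Hui Thm. 1.1 in cofinite `GL(1)` form (text of `WeakAbelianSummandHecke`), Clozel's Hecke field
(`Clozel1990_heckeEigenvalueField`) and Arthur–Clozel (2.2); the CONJECTURE Buzzard–Gee 3.1.6 for
L-algebraic cuspidal `GL_2` (`hLA2`); and the four OPEN REGIONS `H3irr` (rank 3, irregular `π`),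
`H3esd` (rank 3, `K` neither totally real nor CM, `π` regular and essentially self-dual at Satake
level), `H4att` (rank `≥ 4`, `K` totally real or CM: irreducibility of the representation attached to
a regular algebraic `π'`), `H4rest` (rank `≥ 4`, `π` irregular or `K` neither totally real nor CM) —
the text of `IrreducibleOffSector` holds verbatim (every `n ≥ 1`, every `K`, every L-algebraic
cuspidal `π` off the sector, every `ℓ`, `ι` and every a.e.-compatible `ρ`).
[cite: BockleHui2025, Theorem 1.1 and Theorem 1.2] [cite: BuzzardGeeLMS2014, Conj. 3.1.6] -/
theorem irreducibleOffSector_text_of_open_regions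
    (h27 : exists_galoisRep_of_regularAlgebraic)
    (hBH : isIrreducible_galoisRep_gl3_totallyReal)
    (hWA : ∀ (K : Type) [Field K] [NumberField K] (h1 : isCompact_glFiniteIntegralLevel 1 K) (ℓ : ℕ) [Fact ℓ.Prime] (n : ℕ) (E : Type) [Field E] [NumberField E] (e : E →+* PadicAlgCl ℓ) (ρ : FramedGaloisRep K (PadicAlgCl ℓ) n), ρ.toGaloisRep.IsSemisimple → (∀ᶠ v in cofinite, ρ.IsUnramifiedAt v ∧ ∃ P : Polynomial E, ρ.HasFrobCharpolyAt v (P.map e)) → ∀ (ψ : FramedGaloisRep K (PadicAlgCl ℓ) 1), (∀ᶠ v in cofinite, ρ.IsUnramifiedAt v ∧ ψ.IsUnramifiedAt v ∧ ∀ 𝔓 ∈ v.primesAbove, ∀ σ : Field.absoluteGaloisGroup K, IsArithFrobAt (𝓞 K) σ 𝔓 → ψ.charpoly σ ∣ ρ.charpoly σ) → ∀ (ι : PadicAlgCl ℓ ≃+* ℂ), ∃ χ : CuspidalAutomorphicRepData 1 K h1, χ.1.IsRegularAlgebraic ∧ ∀ᶠ v in cofinite, ∃ c : ℂ, χ.1.HasSatakeParamAt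 v {c} ∧ ψ.IsUnramifiedAt v ∧ ψ.HasFrobCharpolyAt v (arithFrobPolyOfSatake ι v.residueCard 1 {c}))
    (hHE : Clozel1990_heckeEigenvalueField)
    (h22 : JacquetShalika1981_partialPairL_boundary_repData)
    -- the conjecture: Buzzard–Gee 3.1.6 for L-algebraic cuspidal `GL_2` (unramified places)
    (hLA2 : ∀ (K : Type) [Field K] [NumberField K] (hcpt : isCompact_glFiniteIntegralLevel 2 K)
      (π : CuspidalAutomorphicRepData 2 K hcpt), π.1.IsLAlgebraic →
        ∃ E : Subfield ℂ, FiniteDimensional ℚ E ∧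
          ∀ᶠ v in cofinite, ∀ α : Multiset ℂ, π.1.HasSatakeParamAt v α →
            ∀ i ≤ 2, α.esymm i ∈ E)
    -- open region: rank 3, irregular `π`
    (H3irr : ∀ (K : Type) [Field K] [NumberField K] (hcpt : isCompact_glFiniteIntegralLevel 3 K)
      (π : CuspidalAutomorphicRepData 3 K hcpt), π.1.IsLAlgebraic →
        (¬ ∃ T : InfinityType K 3, π.1.HasInfinityType T ∧ T.IsRegular) →
          ∀ (ℓ : ℕ) [Fact ℓ.Prime] (ι : PadicAlgCl ℓ ≃+* ℂ) (ρ : FramedGaloisRep K (PadicAlgCl ℓ) 3),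
            (∀ᶠ v in cofinite, SatakeFrobCompatibleAt ι π.1 ρ v) →
              ρ.toGaloisRep.IsIrreducible)
    -- open region: rank 3, `K` neither totally real nor CM, `π` regular and essentially self-dual
    (H3esd : ∀ (K : Type) [Field K] [NumberField K], ¬ IsTotallyReal K → ¬ IsCMField K →
      ∀ (h1 : isCompact_glFiniteIntegralLevel 1 K) (hcpt : isCompact_glFiniteIntegralLevel 3 K)
        (π : CuspidalAutomorphicRepData 3 K hcpt), π.1.IsLAlgebraic →
          (∃ T : InfinityType K 3, π.1.HasInfinityType T ∧ T.IsRegular) →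
            (∃ η : CuspidalAutomorphicRepData 1 K h1, ∀ᶠ v in cofinite,
              ∀ α : Multiset ℂ, π.1.HasSatakeParamAt v α →
                ∃ c : ℂ, η.1.HasSatakeParamAt v {c} ∧ α.map (fun a => a⁻¹) = α.map (fun a => c * a)) →
              ∀ (ℓ : ℕ) [Fact ℓ.Prime] (ι : PadicAlgCl ℓ ≃+* ℂ) (ρ : FramedGaloisRep K (PadicAlgCl ℓ) 3),
                (∀ᶠ v in cofinite, SatakeFrobCompatibleAt ι π.1 ρ v) →
                  ρ.toGaloisRep.IsIrreducible)
    -- open region: rank `≥ 4`, `K` totally real or CM: irreducibility of the attached representation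
    (H4att : ∀ (n : ℕ), 4 ≤ n → ∀ (K : Type) [Field K] [NumberField K], (IsTotallyReal K ∨ IsCMField K) →
      ∀ (hcpt : isCompact_glFiniteIntegralLevel n K) (π' : CuspidalAutomorphicRepData n K hcpt),
        π'.1.IsRegularAlgebraic →
          ∀ (ℓ : ℕ) [Fact ℓ.Prime] (ι : PadicAlgCl ℓ ≃+* ℂ) (r : FramedGaloisRep K (PadicAlgCl ℓ) n),
            r.toGaloisRep.IsSemisimple →
              (∀ (v : HeightOneSpectrum (𝓞 K)) (β : Multiset ℂ), π'.1.HasSatakeParamAt v β →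
                ((ℓ : ℕ) : 𝓞 K) ∉ v.asIdeal →
                  r.IsUnramifiedAt v ∧ r.HasFrobCharpolyAt v (arithFrobPolyOfSatake ι v.residueCard n β)) →
              r.toGaloisRep.IsIrreducible)
    -- open region: rank `≥ 4`, `π` irregular or `K` neither totally real nor CM
    (H4rest : ∀ (n : ℕ), 4 ≤ n → ∀ (K : Type) [Field K] [NumberField K]
      (hcpt : isCompact_glFiniteIntegralLevel n K) (π : CuspidalAutomorphicRepData n K hcpt),
        π.1.IsLAlgebraic →
          ¬ ((IsTotallyReal K ∨ IsCMField K) ∧ ∃ T : InfinityType K n, π.1.HasInfinityType T ∧ T.IsRegular) →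
            ∀ (ℓ : ℕ) [Fact ℓ.Prime] (ι : PadicAlgCl ℓ ≃+* ℂ) (ρ : FramedGaloisRep K (PadicAlgCl ℓ) n),
              (∀ᶠ v in cofinite, SatakeFrobCompatibleAt ι π.1 ρ v) → ρ.toGaloisRep.IsIrreducible) :
    ∀ (n : ℕ) (K : Type) [Field K] [NumberField K] (hcpt : isCompact_glFiniteIntegralLevel n K), 0 < n → ∀ (π : CuspidalAutomorphicRepData n K hcpt), π.1.IsLAlgebraic → ¬ (n = 3 ∧ IsCMField K ∧ ∃ T : InfinityType K n, π.1.HasInfinityType T ∧ T.IsRegular) → ∀ (ℓ : ℕ) [Fact ℓ.Prime] (ι : PadicAlgCl ℓ ≃+* ℂ) (ρ : FramedGaloisRep K (PadicAlgCl ℓ) n), (∀ᶠ v : HeightOneSpectrum (𝓞 K) in cofinite, SatakeFrobCompatibleAt ι π.1 ρ v) → ρ.toGaloisRep.IsIrreducible := by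
  intro n K _ _ hcpt hn π hL hsec ℓ _ ι ρ hρ
  rcases le_or_gt 4 n with h4 | h4
  · -- rank `≥ 4`
    haveI : NeZero n := ⟨by omega⟩
    by_cases hc : (IsTotallyReal K ∨ IsCMField K) ∧ ∃ T : InfinityType K n, π.1.HasInfinityType T ∧ T.IsRegular
    · exact isIrreducible_of_isRegular_of_galoisRep_irreducible (fun n K _ _ hcpt => h27 hcpt) hc.1 ι
        (fun π' hRA r hss hr => H4att n h4 K hc.1 hcpt π' hRA ℓ ι r hss hr) π hL hc.2 ρ hρ
    · exact H4rest n h4 K hcpt π hL hc ℓ ι ρ hρ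
  interval_cases n
  · -- rank one
    exact isIrreducible_of_rank_one ρ
  · -- rank two: L-arithmeticity (BG 3.1.6) + Böckle–Hui + Jacquet–Shalika
    exact isIrreducible_rank_two_of_isLArithmetic hWA h22 π (hLA2 K hcpt π hL) ι ρ hρ
  · -- rank three
    by_cases hreg : ∃ T : InfinityType K 3, π.1.HasInfinityType T ∧ T.IsRegular
    · by_cases hTR : IsTotallyReal K
      · exact isIrreducible_rank_three_totallyReal_of_isRegular (fun n K _ _ hcpt => h27 hcpt) hBH hTR π
          hL hreg ι ρ hρ
      by_cases hCM : IsCMField K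
      · exact absurd ⟨rfl, hCM, hreg⟩ hsec
      have h1 : isCompact_glFiniteIntegralLevel 1 K := isCompact_glFiniteIntegralLevel_holds 1 K
      by_cases hesd : ∃ η : CuspidalAutomorphicRepData 1 K h1,
          ∀ᶠ v : HeightOneSpectrum (𝓞 K) in cofinite, ∀ α : Multiset ℂ, π.1.HasSatakeParamAt v α →
            ∃ c : ℂ, η.1.HasSatakeParamAt v {c} ∧ α.map (fun a => a⁻¹) = α.map (fun a => c * a)
      · exact H3esd K hTR hCM h1 hcpt π hL hreg hesd ℓ ι ρ hρ
      · exact isIrreducible_rank_three_of_isRegular_of_not_essSelfDual hWA hHE h22 h1 π hL hreg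
          (fun η hη => hesd ⟨η, hη⟩) ι ρ hρ
    · exact H3irr K hcpt π hL hreg ℓ ι ρ hρ

end Summit.Langlands.Langlands.Theorems.IrreducibleOffSector

end
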